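import Summits.ResolutionOfSingularities.ResolutionOfSingularities.Theorems.WeightedInvariantLocalWeightedDropTrackCDefs
import Summits.ResolutionOfSingularities.ResolutionOfSingularities.Theorems.WeightedInvariantLocalWeightedDropTupleGameWon

/-!
# Track T4 of the engine crux `LocalWeightedDrop`: definition of `TWonAt`

[OURS · L1 W4.3 · chain w43, Track T4 (tame double points at N = 4 modulo F-32bR); stub worker 4] Engine crux `LocalWeightedDrop`
(stmt-ResolutionOfSingularities-8899).  NOT a statement of any manuscript; the games are the programme's own.

Track T4 transfers an embedded resolution SEQUENCE of the surface `V(a₀) ⊆ Z₀ = Spec k⟦x₀,x₁,x₂⟧` (the corrected Cossart–Jannsen–Saito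
fact F-32bR) into a winning strategy of the one-entry coefficient-tuple game `TupleGame.Drop k 3 0` for the marked germ `(a₀, 2)` — the
tame lift of the double point `y² + a₀(x₀,x₁,x₂)` in four variables.  The bookkeeping predicate of the induction along the sequence,
companion of Track C's `TrackC.WonAt`:

* `TWonAt a σ` — at every framed point `z` of the `Z₀`-scheme `σ : Z ⟶ Z₀` (Cohen frame `TrackC.Frame σ z`), every NON-ZERO BAD
  germ `b ∈ k⟦X₀,X₁,X₂⟧` (order `≥ 2`) DIVIDING the total transform of `a` read in the frame is in the inductive winning region
  `TupleGame.TWon k 3 0` of the one-entry tuple game (`…TupleGameWon`).  The game position is a divisor of the total transform,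
  the divided-out part being exceptional monomials (squares of which the game removes by its floor weight).
-/

noncomputable section

open CategoryTheory AlgebraicGeometry TopologicalSpace IsLocalRing
open Literature.AlgebraicGeometry.Resolution

set_option linter.dupNamespace false -- mandated namespace of this single-conjunct summit

namespace Summit.ResolutionOfSingularities.ResolutionOfSingularities.Theorems.TrackT4

variable {k : Type} [Field k]

/-- **`TWonAt a σ`.** At every framed point `z` of the `Z₀`-scheme `σ : Z ⟶ Z₀ = Spec k⟦x₀,x₁,x₂⟧`, every non-zero bad germ
`b ∈ k⟦X₀,X₁,X₂⟧` dividing the total transform of `a` read in the frame is won in the one-entry coefficient-tuple game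
`TupleGame.TWon k 3 0`. [OURS · folklore] -/
def TWonAt (a : MvPowerSeries (Fin 3) k) {Z : Scheme.{0}} (σ : Z ⟶ Spec (.of (MvPowerSeries (Fin 3) k))) : Prop :=
  ∀ (z : Z) (hN : IsNoetherianRing (Z.presheaf.stalk z)) (F : @TrackC.Frame k _ Z σ z hN)
    (b : MvPowerSeries (Fin 3) k),
    b ∣ F.e (algebraMap _ _ (TrackC.totalGerm σ z a)) → b ≠ 0 → TupleGame.Bad (fun _ : Fin (0 + 1) => b) →
      TupleGame.TWon k 3 0 (fun _ : Fin (0 + 1) => b)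

/-- `TWonAt` from a frame-wise statement about ALL divisors (the form the end game provides). [OURS · folklore] -/
theorem tWonAt_of_forall_dvd (a : MvPowerSeries (Fin 3) k) {Z : Scheme.{0}}
    (σ : Z ⟶ Spec (.of (MvPowerSeries (Fin 3) k)))
    (h : ∀ (z : Z) (hN : IsNoetherianRing (Z.presheaf.stalk z)) (F : @TrackC.Frame k _ Z σ z hN)
      (b : MvPowerSeries (Fin 3) k), b ∣ F.e (algebraMap _ _ (TrackC.totalGerm σ z a)) →
        TupleGame.TWon k 3 0 (fun _ : Fin (0 + 1) => b)) : TWonAt a σ :=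
  fun z hN F b hb _ _ => h z hN F b hb

end Summit.ResolutionOfSingularities.ResolutionOfSingularities.Theorems.TrackT4

end
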